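/-
Copyright: the b2b-balaban cell (near-miss cell 7), T⁴-continuum fan-out, lineage t4-ne7b-p1 (node U5c COUNT member).
Released under the licence of the surrounding project.
-/
import Summits.QuantumFields.BalabanUV.T4Continuum.Support.PartnerMultiplicityZ

/-!
# The room condition scales with the profile amplitude: `hlabG`∕`hlabZ` at `θ < a·A₀²`

Summits-side support leaf of the T⁴-continuum cell (rung (B)+1 on a FINITE torus only; NOT infinite volume, NOT the
mass gap, NOT the Clay statement; NOT a proof of the spine estimate NE7b).  Lineage `t4-ne7b-p1`, node U5c, wall (GM),
located item G-ne7bp1g18-2 — the (E2)-side DISPLAYED CONSTANT of the binder re-typings, sharpened.  [folklore]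
bookkeeping over the lineage's OWN typed carrier; nothing is quoted from print and nothing printed is asserted.

WHY.  `Support/PartnerMultiplicityG` (class-linear binder `hlabG`) and `Support/PartnerMultiplicityZ` (zone-crowding
binder `hlabZ`) pay a class-linear surcharge `θ·Σ_{births}(d′+1)` by lowering the quadratic birth constant `a` by `θ`,
using only the profile floor `p₀(g_s) ≥ 1`; their displayed room conditions read `θ < C.a`, resp. `zoneRate < C.a`.
But a birth's credit is `a·p₀(g_s)²·(d′+1)` with `p₀(g) = A₀·(log g⁻²)^{p₀}` (`p0Profile`), and the run regime
`1 ≤ log (g_s²)⁻¹` gives the floor `p₀(g_s) ≥ A₀`: lowering `a` by `θ∕A₀²` already releases `θ·(d′+1)` per birth.  So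
the room the surcharge needs is `θ < a·A₀²` — it SCALES WITH THE SQUARE OF THE PROFILE AMPLITUDE (a free symbolic
constant of the typed `Consts`, unconstrained by `Valid`), which is the honest form of the (E2)-side question (the typed
crowding constant `crowdA` is astronomically large; whether print's `a`, `A₀` — CONTEXT: `½γ₀A₁²` of (1.79), the
amplitude of `p₀(g_k)` — leave that room is not decided here).

WHAT.  §1 `credit_lowerA_add_le_floor` ∕ `credits_lowerA_add_le_floor` ∕ `exp_mul_fatSum_mul_exp_neg_credits_le_floor`:
with a floor `0 < P ≤ p₀(g_s)` at the birth steps, lowering `a` by `θ∕P²` pays `θ·Σ_{births}(d′+1)`; §2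
`A₀_le_p0Profile`: the run regime gives the floor `P = A₀`; §3 **`exists_irThreshold_relWeightBoundG_floor`**: the
`hlabG` chain with the displayed binders `0 < C.A₀`, `0 ≤ θ`, `θ < C.a·C.A₀²` (instead of `1 ≤ C.A₀`, `θ < C.a`);
§4 **`exists_irThreshold_relWeightBoundZ_floor`**: the `hlabZ` chain with `0 < C.A₀`, `zoneRate Kz p σ ε θ < C.a·C.A₀²`.
Everything else VERBATIM as the landed statements.  NE7b discharge: no date.

HONEST DEPENDENCY (cell): continuum YM on T⁴ ⇐ BetaPertH ∧ nine spine estimates (0/9 proved); BetaPertH ⇐ (D1) ∧ (D4)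
∧ CAP+tail.  This file changes none of it.
-/

open Finset
open Literature.MathematicalPhysics.QuantumFieldTheory.Balaban1983to89
open T4PersistenceDictionary T4PersistentHistoryCount T4BankedInduction T4PrintedShapeBanking
open T4WeightBudget T4GlobalDenominator T4LiveClassFibration T4LiveStructureGas T4LiveGasToTerms T4RecordPriceSeam
open T4PartnerMultiplicity
open Summit.QuantumFields.BalabanUV.T4Continuum.PlacementBatch
open Summit.QuantumFields.BalabanUV.T4Continuum.PlacementSkeleton
open Summit.QuantumFields.BalabanUV.T4Continuum.PartnerMultiplicityF
open Summit.QuantumFields.BalabanUV.T4Continuum.PartnerMultiplicityG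
open Summit.QuantumFields.BalabanUV.T4Continuum.PartnerMultiplicityZ
open Summit.QuantumFields.BalabanUV.T4Continuum.Crowding

namespace Summit.QuantumFields.BalabanUV.T4Continuum.PartnerMultiplicityFloor

noncomputable section

/-! ## §1 Lowering `a` by `θ∕P²` against a profile floor `P` -/

/-- **ONE BIRTH, WITH A FLOOR.**  If `0 < P ≤ p₀(g_s)` at the birth's step and `θ ≥ 0`:
`credit (lowerA C (θ∕P²)) g e + θ·(d′ + 1) ≤ credit C g e`. [folklore] -/
theorem credit_lowerA_add_le_floor {C : T4PrintedShapeBanking.Consts} {g : ℕ → ℝ} {θ P : ℝ} (hθ : 0 ≤ θ)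
    (hP : 0 < P) {e : PEv} (h : e.kind = 0) (hPe : P ≤ p0Profile C.A₀ C.p₀ (g e.step)) :
    credit (lowerA C (θ / P ^ 2)) g e + θ * ((e.fat : ℝ) + 1) ≤ credit C g e := by
  rw [credit_of_kind_eq_zero _ _ h, credit_of_kind_eq_zero _ _ h, lowerA_a, lowerA_A₀, lowerA_p₀]
  set Q₀ := p0Profile C.A₀ C.p₀ (g e.step)
  have hf : 0 ≤ (e.fat : ℝ) + 1 := by positivity
  have hQ2 : P ^ 2 ≤ Q₀ ^ 2 := pow_le_pow_left₀ hP.le hPe 2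
  have hP2 : 0 < P ^ 2 := by positivity
  have key : θ * ((e.fat : ℝ) + 1) ≤ θ / P ^ 2 * Q₀ ^ 2 * ((e.fat : ℝ) + 1) := by
    have h1 : θ ≤ θ / P ^ 2 * Q₀ ^ 2 := by
      rw [div_mul_eq_mul_div, le_div_iff₀ hP2]
      exact mul_le_mul_of_nonneg_left hQ2 hθ
    exact mul_le_mul_of_nonneg_right h1 hf
  nlinarith

/-- **ALL EVENTS, WITH A FLOOR.**
`credits (credit (lowerA C (θ∕P²)) g) G + θ·Σ_{kind-0 events}(d′+1) ≤ credits (credit C g) G`. [folklore] -/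
theorem credits_lowerA_add_le_floor {C : T4PrintedShapeBanking.Consts} {g : ℕ → ℝ} {θ P : ℝ} (hθ : 0 ≤ θ)
    (hP : 0 < P) (G : Gen PEv) (hPe : ∀ e ∈ G.events, e.kind = 0 → P ≤ p0Profile C.A₀ C.p₀ (g e.step)) :
    credits (credit (lowerA C (θ / P ^ 2)) g) G + θ * ∑ e ∈ G.events.filter (fun e => e.kind = 0), ((e.fat : ℝ) + 1) ≤
      credits (credit C g) G := by
  unfold credits
  rw [sum_filter, mul_sum, ← sum_add_distrib]
  refine sum_le_sum fun e he => ?_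
  by_cases h : e.kind = 0
  · rw [if_pos h]; exact credit_lowerA_add_le_floor hθ hP h (hPe e he h)
  · rw [if_neg h, mul_zero, add_zero, credit_lowerA_of_kind_ne C g _ h]

/-- **THE CLASS-LINEAR SURCHARGE AGAINST THE CREDITS, WITH A FLOOR.**  For a consistent genealogy with the floor
`0 < P ≤ p₀(g_s)` at its birth steps and `θ ≥ 0`:
`exp(θ·Σ_{births}(d′+1)) · e^{−credits (credit C g) G} ≤ e^{−credits (credit (lowerA C (θ∕P²)) g) G}`. [folklore] -/
theorem exp_mul_fatSum_mul_exp_neg_credits_le_floor {C : T4PrintedShapeBanking.Consts} {K : ℕ} {R : ℕ → ℕ}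
    {g : ℕ → ℝ} {θ P : ℝ} (hθ : 0 ≤ θ) (hP : 0 < P) {G : Gen PEv} (hc : Consistent C K R G)
    (hPe : ∀ e ∈ G.events, e.kind = 0 → P ≤ p0Profile C.A₀ C.p₀ (g e.step)) :
    Real.exp (θ * ∑ b ∈ births G, ((b.fat : ℝ) + 1)) * Real.exp (-credits (credit C g) G) ≤
      Real.exp (-credits (credit (lowerA C (θ / P ^ 2)) g) G) := by
  have h1 := credits_lowerA_add_le_floor hθ hP G hPe
  have h2 : ∑ b ∈ births G, ((b.fat : ℝ) + 1) ≤ ∑ e ∈ G.events.filter (fun e => e.kind = 0), ((e.fat : ℝ) + 1) :=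
    sum_le_sum_of_subset_of_nonneg (births_subset_filter hc) fun _ _ _ => by positivity
  rw [← Real.exp_add, Real.exp_le_exp]
  nlinarith [mul_le_mul_of_nonneg_left h2 hθ]

/-! ## §2 The run regime gives the floor `P = A₀` -/

/-- **THE AMPLITUDE IS A FLOOR**: `0 ≤ A₀` and `1 ≤ log (x²)⁻¹` give `A₀ ≤ p₀(x) = A₀·(log (x²)⁻¹)^{p₀}`. [folklore] -/
theorem A₀_le_p0Profile {A₀ : ℝ} (hA : 0 ≤ A₀) (p₀ : ℕ) {x : ℝ} (hx : 1 ≤ Real.log (x ^ 2)⁻¹) :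
    A₀ ≤ p0Profile A₀ p₀ x := by
  unfold p0Profile
  have h1 : (1 : ℝ) ≤ (Real.log (x ^ 2)⁻¹) ^ p₀ := one_le_pow₀ hx
  nlinarith

/-! ## §3 The class-linear chain at `θ < a·A₀²` -/

section EndToEnd

variable {γ κ ι : Type*} [DecidableEq γ] [DecidableEq κ] {l₀ : ℝ} {K₀ : ℕ} {π : ℕ → ι → κ} {T : ℕ → Finset ι}
  {A A' : ℕ → ℝ → ι → ℝ} {Bad' : ℕ → ℝ → Finset κ} {dead dead' : ℕ → ℝ → ι → ℝ} {F Rf F' Rf' : ℕ → κ → ℝ}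
  {nlow nup mlow mup : ℕ → ℝ → ℝ} {Cn : ℝ}

/-- **`hlabG` WITH THE ROOM `θ < a·A₀²`.**  `PartnerMultiplicityG.exists_irThreshold_relWeightBoundG` VERBATIM except
the displayed binders `0 < C.A₀` (was `1 ≤ C.A₀`) and `θ < C.a · C.A₀ ^ 2` (was `θ < C.a`): the landed `M`-chain run at
`lowerA C (θ ∕ A₀²)` with the floor `p₀ ≥ A₀` of the run regime. [folklore] -/
theorem exists_irThreshold_relWeightBoundG_floor (C : T4PrintedShapeBanking.Consts) (hC : C.Valid) {θ : ℝ}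
    (hθ : 0 ≤ θ) (hA₀ : 0 < C.A₀) (ha : θ < C.a * C.A₀ ^ 2) {L r : ℕ} (hL : 1 ≤ L) {β₀ : ℝ} (hβ : 0 ≤ β₀)
    (hrq : r * (C.q' + 1) < C.p₀)
    (Cell : ℕ → ℕ → Finset γ) {V Λ : ℝ} (hV : 0 ≤ V) (hΛ : 0 < Λ)
    (hcell : ∀ K a, ((Cell K a).card : ℝ) ≤ V * Λ ^ a) (E B : ℕ → ℕ → Finset PEv)
    (hE : ∀ K j, ∀ e ∈ E K j, PEv.step e ∈ Ioc j K) (jstar : ℕ → ℕ) (hj : ∀ K, jstar K ≤ K) {c : ℝ} (hc : 0 < c)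
    (hfrac : ∀ K : ℕ, c * K ≤ ((K - jstar K : ℕ) : ℝ))
    (hA : Regeneration l₀ π T A Bad' dead F Rf nlow nup Cn K₀)
    (hA' : Regeneration l₀ π T A' Bad' dead' F' Rf' mlow mup Cn K₀) (hCn : 0 ≤ Cn) :
    ∃ x₀ : ℝ, ∀ (R : ℕ → ℕ → ℕ) (g : ℕ → ℕ → ℝ) (β' : ℕ → ℝ),
      (∀ K, K₀ ≤ K → B14.FlowIneq27 (g K) (β' K) β₀ C.p₀ K) →
      (∀ K, K₀ ≤ K → B14FlowStep.FlowIneq29 (R K) (g K) L (β' K) β₀ K) →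
      (∀ K, K₀ ≤ K → ∀ s, s ≤ K → B14.IsRj L r (g K s) (R K s)) →
      (∀ K, K₀ ≤ K → ∀ s, s ≤ K → 1 ≤ Real.log ((g K s) ^ 2)⁻¹) →
      (∀ K, K₀ ≤ K → x₀ ≤ Real.log ((g K K) ^ 2)⁻¹) →
      ∀ {ρbar ηbar : ℝ}, (∀ K j, ∑ b ∈ B K j, rho C (g K) b ≤ ρbar) →
      (∀ K j, ∀ t ∈ Ioc j K, ∑ e ∈ E K j with PEv.step e = t, eta C e ≤ ηbar) →
      Λ * Real.exp (ηbar - C.κ₁) < 1 →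
      ∀ {Λ' : ℝ}, 0 ≤ Λ' → Λ' * Real.exp (-C.κ₁) ≤ 1 →
      ∀ (y : ℕ → ℕ → γ → PEv → Finset PEv → ℝ),
      (∀ K, ∀ j ≤ K, ∀ z ∈ Cell K (K - j), ∀ b ∈ B K j,
        ∀ Q ∈ records (dictW (R K) C.n₁) j K (E K j) b, 0 ≤ y K j z b Q) →
      (∀ K, K₀ ≤ K → ∀ j ≤ K, ∀ z ∈ Cell K (K - j), ∀ b ∈ B K j,
        ∀ Q ∈ records (dictW (R K) C.n₁) j K (E K j) b,
        y K j z b Q ≤ 0 ∨ ∃ G : Gen PEv, Consistent C K (R K) G ∧ G.WF (dictW (R K) C.n₁) ∧ G.rootStep = j ∧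
          K < G.reach (dictW (R K) C.n₁) ∧ G.root = b ∧ G.events.erase G.root = Q ∧
          y K j z b Q ≤ Real.exp (θ * ∑ b' ∈ births G, ((b'.fat : ℝ) + 1)) *
            (Λ' ^ partnerAges PEv.step G * (Real.exp (-credits (credit C (g K)) G) *
              Real.exp (lifeCost (dictW (R K) C.n₁) (cost C K (R K)) G)))) →
      ∀ (str : ℕ → κ → Finset (Slot γ PEv)),
      (∀ K t, |t| ≤ l₀ → K₀ ≤ K → Set.InjOn (str K) (Bad' K t)) →
      (∀ K t, |t| ≤ l₀ → K₀ ≤ K → ∀ c ∈ Bad' K t,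
        str K c ⊆ liveSlots Cell (dictW (R K) C.n₁) E B K ∧
          ∃ o ∈ oldSlots Cell (dictW (R K) C.n₁) E B jstar K, o ∈ str K c) →
      (∀ K t, |t| ≤ l₀ → K₀ ≤ K → ∀ c ∈ Bad' K t, F K c * Rf K c ≤ famWeight (slotPrice (y K)) (str K c)) →
      (∀ K t, |t| ≤ l₀ → K₀ ≤ K → ∀ c ∈ Bad' K t, F' K c * Rf' K c ≤ famWeight (slotPrice (y K)) (str K c)) →
      ∃ K₁, K₀ ≤ K₁ ∧ RelWeightBound l₀ T A A' (fun K t => if K₁ ≤ K then badOfClass π T Bad' K t else ∅)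
        (Set.indicator {K | K₁ ≤ K} (fun K => Cn * recordsBudget ρbar C.κ₁ V Λ ηbar jstar K)) := by
  set θ' := θ / C.A₀ ^ 2 with hθ'
  have hA2 : 0 < C.A₀ ^ 2 := by positivity
  have hC' : (lowerA C θ').Valid := lowerA_valid hC _
  have ha' : 0 < (lowerA C θ').a := by
    rw [lowerA_a, hθ', sub_pos, div_lt_iff₀ hA2]
    exact ha
  have hA₀' : 0 < (lowerA C θ').A₀ := by rw [lowerA_A₀]; exact hA₀
  obtain ⟨x₀, hx₀⟩ := exists_irThreshold_relWeightBoundM (lowerA C θ') hC' ha' hA₀' hL hβ hrq Cell hV hΛ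
    hcell E B hE jstar hj hc hfrac hA hA' hCn
  refine ⟨x₀, ?_⟩
  intro R g β' h27 h29 hR hx1 hir ρbar ηbar hρbar hηbar hr Λ' hΛ0 hΛ1 y hy0 hlabG str hinj hstr hF hF'
  have hlabM : ∀ K, K₀ ≤ K → ∀ j ≤ K, ∀ z ∈ Cell K (K - j), ∀ b ∈ B K j,
      ∀ Q ∈ records (dictW (R K) C.n₁) j K (E K j) b,
      y K j z b Q ≤ 0 ∨ ∃ G : Gen PEv, Consistent (lowerA C θ') K (R K) G ∧ G.WF (dictW (R K) C.n₁) ∧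
        G.rootStep = j ∧ K < G.reach (dictW (R K) C.n₁) ∧ G.root = b ∧ G.events.erase G.root = Q ∧
        y K j z b Q ≤ Λ' ^ partnerAges PEv.step G * (Real.exp (-credits (credit (lowerA C θ') (g K)) G) *
          Real.exp (lifeCost (dictW (R K) C.n₁) (cost C K (R K)) G)) := by
    intro K hK j hj z hz b hb Q hQ
    rcases hlabG K hK j hj z hz b hb Q hQ with h0 | ⟨G, hcG, hW, hrs, hKr, hroot, hQ', hy⟩
    · exact Or.inl h0
    · refine Or.inr ⟨G, (consistent_lowerA_iff C θ' K (R K) G).2 hcG, hW, hrs, hKr, hroot, hQ', hy.trans ?_⟩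
      have hPe : ∀ e ∈ G.events, e.kind = 0 → C.A₀ ≤ p0Profile C.A₀ C.p₀ (g K e.step) := fun e he _ =>
        A₀_le_p0Profile hA₀.le C.p₀ (hx1 K hK e.step (step_le_of_consistent hcG e he))
      have key := exp_mul_fatSum_mul_exp_neg_credits_le_floor (g := g K) hθ hA₀ hcG hPe
      have hX : 0 ≤ Real.exp (lifeCost (dictW (R K) C.n₁) (cost C K (R K)) G) := (Real.exp_pos _).le
      have hΛp : 0 ≤ Λ' ^ partnerAges PEv.step G := pow_nonneg hΛ0 _
      calc Real.exp (θ * ∑ b' ∈ births G, ((b'.fat : ℝ) + 1)) *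
            (Λ' ^ partnerAges PEv.step G * (Real.exp (-credits (credit C (g K)) G) *
              Real.exp (lifeCost (dictW (R K) C.n₁) (cost C K (R K)) G)))
          = Λ' ^ partnerAges PEv.step G *
              ((Real.exp (θ * ∑ b' ∈ births G, ((b'.fat : ℝ) + 1)) * Real.exp (-credits (credit C (g K)) G)) *
                Real.exp (lifeCost (dictW (R K) C.n₁) (cost C K (R K)) G)) := by ring
        _ ≤ Λ' ^ partnerAges PEv.step G * (Real.exp (-credits (credit (lowerA C θ') (g K)) G) *
              Real.exp (lifeCost (dictW (R K) C.n₁) (cost C K (R K)) G)) :=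
            mul_le_mul_of_nonneg_left (mul_le_mul_of_nonneg_right key hX) hΛp
  exact hx₀ R g β' h27 h29 hR hx1 hir hρbar hηbar hr hΛ0 hΛ1 y hy0 hlabM str hinj hstr hF hF'

/-! ## §4 The zone-crowding chain at `zoneRate < a·A₀²` -/

/-- **`hlabZ` WITH THE ROOM `zoneRate < a·A₀²`.**  `PartnerMultiplicityZ.exists_irThreshold_relWeightBoundZ` VERBATIM
except the displayed binders `0 < C.A₀` (was `1 ≤ C.A₀`) and `zoneRate Kz p σ ε θ < C.a · C.A₀ ^ 2` (was `< C.a`).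
[folklore] -/
theorem exists_irThreshold_relWeightBoundZ_floor (C : T4PrintedShapeBanking.Consts) (hC : C.Valid) {Kz p σ ε θ : ℝ}
    (hKz : 1 ≤ Kz) (hp : 0 ≤ p) (h0 : 0 < σ) (h1 : σ < 1) (hε : 0 < ε) (hθ : 0 < θ) (hA₀ : 0 < C.A₀)
    (ha : zoneRate Kz p σ ε θ < C.a * C.A₀ ^ 2) {L r : ℕ} (hL : 1 ≤ L) {β₀ : ℝ} (hβ : 0 ≤ β₀)
    (hrq : r * (C.q' + 1) < C.p₀)
    (Cell : ℕ → ℕ → Finset γ) {V Λ : ℝ} (hV : 0 ≤ V) (hΛ : 0 < Λ)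
    (hcell : ∀ K a, ((Cell K a).card : ℝ) ≤ V * Λ ^ a) (E B : ℕ → ℕ → Finset PEv)
    (hE : ∀ K j, ∀ e ∈ E K j, PEv.step e ∈ Ioc j K) (jstar : ℕ → ℕ) (hj : ∀ K, jstar K ≤ K) {c : ℝ} (hc : 0 < c)
    (hfrac : ∀ K : ℕ, c * K ≤ ((K - jstar K : ℕ) : ℝ))
    (hA : Regeneration l₀ π T A Bad' dead F Rf nlow nup Cn K₀)
    (hA' : Regeneration l₀ π T A' Bad' dead' F' Rf' mlow mup Cn K₀) (hCn : 0 ≤ Cn) :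
    ∃ x₀ : ℝ, ∀ (R : ℕ → ℕ → ℕ) (g : ℕ → ℕ → ℝ) (β' : ℕ → ℝ),
      (∀ K, K₀ ≤ K → B14.FlowIneq27 (g K) (β' K) β₀ C.p₀ K) →
      (∀ K, K₀ ≤ K → B14FlowStep.FlowIneq29 (R K) (g K) L (β' K) β₀ K) →
      (∀ K, K₀ ≤ K → ∀ s, s ≤ K → B14.IsRj L r (g K s) (R K s)) →
      (∀ K, K₀ ≤ K → ∀ s, s ≤ K → 1 ≤ Real.log ((g K s) ^ 2)⁻¹) →
      (∀ K, K₀ ≤ K → x₀ ≤ Real.log ((g K K) ^ 2)⁻¹) →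
      ∀ {ρbar ηbar : ℝ}, (∀ K j, ∑ b ∈ B K j, rho C (g K) b ≤ ρbar) →
      (∀ K j, ∀ t ∈ Ioc j K, ∑ e ∈ E K j with PEv.step e = t, eta C e ≤ ηbar) →
      Λ * Real.exp (ηbar - C.κ₁) < 1 →
      ∀ {Λ' : ℝ}, 0 ≤ Λ' → Λ' * Real.exp ε * Real.exp (-C.κ₁) ≤ 1 →
      ∀ (y : ℕ → ℕ → γ → PEv → Finset PEv → ℝ),
      (∀ K, ∀ j ≤ K, ∀ z ∈ Cell K (K - j), ∀ b ∈ B K j,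
        ∀ Q ∈ records (dictW (R K) C.n₁) j K (E K j) b, 0 ≤ y K j z b Q) →
      (∀ K, K₀ ≤ K → ∀ j ≤ K, ∀ z ∈ Cell K (K - j), ∀ b ∈ B K j,
        ∀ Q ∈ records (dictW (R K) C.n₁) j K (E K j) b,
        y K j z b Q ≤ 0 ∨ ∃ G : Gen PEv, Consistent C K (R K) G ∧ G.WF (dictW (R K) C.n₁) ∧ G.rootStep = j ∧
          K < G.reach (dictW (R K) C.n₁) ∧ G.root = b ∧ G.events.erase G.root = Q ∧
          y K j z b Q ≤ Kz ^ (merges G).card * (∏ e ∈ merges G, Crowding.Q (wcnt G) σ e.step ^ p) *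
            Λ' ^ partnerAges PEv.step G * (Real.exp (-credits (credit C (g K)) G) *
              Real.exp (lifeCost (dictW (R K) C.n₁) (cost C K (R K)) G))) →
      ∀ (str : ℕ → κ → Finset (Slot γ PEv)),
      (∀ K t, |t| ≤ l₀ → K₀ ≤ K → Set.InjOn (str K) (Bad' K t)) →
      (∀ K t, |t| ≤ l₀ → K₀ ≤ K → ∀ c ∈ Bad' K t,
        str K c ⊆ liveSlots Cell (dictW (R K) C.n₁) E B K ∧
          ∃ o ∈ oldSlots Cell (dictW (R K) C.n₁) E B jstar K, o ∈ str K c) →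
      (∀ K t, |t| ≤ l₀ → K₀ ≤ K → ∀ c ∈ Bad' K t, F K c * Rf K c ≤ famWeight (slotPrice (y K)) (str K c)) →
      (∀ K t, |t| ≤ l₀ → K₀ ≤ K → ∀ c ∈ Bad' K t, F' K c * Rf' K c ≤ famWeight (slotPrice (y K)) (str K c)) →
      ∃ K₁, K₀ ≤ K₁ ∧ RelWeightBound l₀ T A A' (fun K t => if K₁ ≤ K then badOfClass π T Bad' K t else ∅)
        (Set.indicator {K | K₁ ≤ K} (fun K => Cn * recordsBudget ρbar C.κ₁ V Λ ηbar jstar K)) := by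
  have hθz : 0 ≤ zoneRate Kz p σ ε θ := zoneRate_nonneg hKz hp h0 h1 hθ.le
  obtain ⟨x₀, hx₀⟩ := exists_irThreshold_relWeightBoundG_floor C hC hθz hA₀ ha hL hβ hrq Cell hV hΛ hcell E B
    hE jstar hj hc hfrac hA hA' hCn
  refine ⟨x₀, ?_⟩
  intro R g β' h27 h29 hR hx1 hir ρbar ηbar hρbar hηbar hr Λ' hΛ0 hΛ1 y hy0 hlabZ str hinj hstr hF hF'
  have hΛ0' : 0 ≤ Λ' * Real.exp ε := mul_nonneg hΛ0 (Real.exp_pos ε).le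
  have hlabG : ∀ K, K₀ ≤ K → ∀ j ≤ K, ∀ z ∈ Cell K (K - j), ∀ b ∈ B K j,
      ∀ Q ∈ records (dictW (R K) C.n₁) j K (E K j) b,
      y K j z b Q ≤ 0 ∨ ∃ G : Gen PEv, Consistent C K (R K) G ∧ G.WF (dictW (R K) C.n₁) ∧
        G.rootStep = j ∧ K < G.reach (dictW (R K) C.n₁) ∧ G.root = b ∧ G.events.erase G.root = Q ∧
        y K j z b Q ≤ Real.exp (zoneRate Kz p σ ε θ * ∑ b' ∈ births G, ((b'.fat : ℝ) + 1)) *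
          ((Λ' * Real.exp ε) ^ partnerAges PEv.step G * (Real.exp (-credits (credit C (g K)) G) *
            Real.exp (lifeCost (dictW (R K) C.n₁) (cost C K (R K)) G))) := by
    intro K hK j hj z hz b hb Q hQ
    rcases hlabZ K hK j hj z hz b hb Q hQ with h0' | ⟨G, hcG, hW, hrs, hKr, hroot, hQ', hy⟩
    · exact Or.inl h0'
    · refine Or.inr ⟨G, hcG, hW, hrs, hKr, hroot, hQ', hy.trans ?_⟩
      have key := zone_surcharge_le (dictW (R K) C.n₁) hKz hp h0 h1 hε hθ hΛ0 hcG hW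
      have hX : 0 ≤ Real.exp (-credits (credit C (g K)) G) *
          Real.exp (lifeCost (dictW (R K) C.n₁) (cost C K (R K)) G) := by positivity
      calc Kz ^ (merges G).card * (∏ e ∈ merges G, Crowding.Q (wcnt G) σ e.step ^ p) *
            Λ' ^ partnerAges PEv.step G * (Real.exp (-credits (credit C (g K)) G) *
              Real.exp (lifeCost (dictW (R K) C.n₁) (cost C K (R K)) G))
          ≤ Real.exp (zoneRate Kz p σ ε θ * ∑ b' ∈ births G, ((b'.fat : ℝ) + 1)) *
              (Λ' * Real.exp ε) ^ partnerAges PEv.step G * (Real.exp (-credits (credit C (g K)) G) *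
              Real.exp (lifeCost (dictW (R K) C.n₁) (cost C K (R K)) G)) := mul_le_mul_of_nonneg_right key hX
        _ = _ := by ring
  exact hx₀ R g β' h27 h29 hR hx1 hir hρbar hηbar hr hΛ0' (by simpa [mul_assoc] using hΛ1) y hy0 hlabG str
    hinj hstr hF hF'

end EndToEnd

/-! ## §5 Sanity -/

namespace Sanity

/-- the floor on an instance: `A₀ = 7`, `p₀ = 3`, `log (x²)⁻¹ ≥ 1` gives `7 ≤ p₀(x)` [folklore] -/
theorem floor_example {x : ℝ} (hx : 1 ≤ Real.log (x ^ 2)⁻¹) : 7 ≤ p0Profile 7 3 x :=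
  A₀_le_p0Profile (by norm_num) 3 hx

end Sanity

end

end Summit.QuantumFields.BalabanUV.T4Continuum.PartnerMultiplicityFloor
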